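import Literature.Probability.LatticeModels.RandomClusterComparisonRatio
import Literature.Probability.Percolation.InsertionTolerance
import HarnessLib

/-!
# FK-continuity transplant, FO-06 (construction half): finite energy of the finite-volume
# random-cluster measures — insertion and deletion tolerance (Grimmett 2006, Thm. (3.1), (3.4))

Cell `fk-continuity` (bschramm), row FO-06 seat B; support file for the FK-continuity transplant
(`--supports stmt-CriticalPhenomena-4575`); builds on p205010 (kernel theorem, internal audit signed;
external expert review pending). No named facts, no sorries, standard axioms.

Grimmett 2006, Thm. (3.1) with (3.4): for `q ≥ 1` the one-edge conditional probabilities of the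
random-cluster measure `φ^B_{G,p,q}` of a finite graph satisfy
`p/(p + q(1-p)) ≤ φ(e open | configuration off e) ≤ p`. We prove the INTEGRATED consequences used
by the Burton–Keane / domain-Markov arguments downstream ("local modification costs at most a
constant factor"), for every event `A` and every finite set `F` of edges of `G`:

* `rcMeasure_real_preimage_insert_le` — one edge: `p · φ{ω | ω ∪ {e} ∈ A} ≤ (p + q(1-p)) · φ(A)`;
* `rcMeasure_pow_mul_real_preimage_openEdges_le` — **insertion tolerance**:
  `(p/(p+q(1-p)))^{|F|} · φ{ω | ω ∪ F ∈ A} ≤ φ(A)` (`0 < p ≤ 1`, `q ≥ 1`);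
* `rcMeasure_real_preimage_erase_le` — one edge: `(1-p) · φ{ω | ω ∖ {e} ∈ A} ≤ φ(A)`;
* `rcMeasure_pow_mul_real_preimage_sdiff_le` — **deletion tolerance**:
  `(1-p)^{|F|} · φ{ω | ω ∖ F ∈ A} ≤ φ(A)` (`0 ≤ p ≤ 1`, `q ≥ 1`).

Proof (weights, Grimmett 2006 (1.2) and the proof of (3.23): adding an edge lowers the cluster count
by at most one, `clusterCount_le_clusterCount_insert_edge_add_one`; removing one raises it by at
most... nothing, `clusterCount_anti`): `p·w(ω) ≤ q(1-p)·w(ω ∪ {e})` for `e ∉ ω`, and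
`(1-p)·w(ω) ≤ p·w(ω ∖ {e})` for `e ∈ ω`; summing over `{ω | ω ∪ {e} ∈ A}` split by the state of
`e`, the map `ω ↦ ω ∪ {e}` being injective on `{e ∉ ω}`. The general-`F` statements follow by
induction on `F`. The `q = 1` (Bernoulli) insertion case is the tree's
`bondPercolation_pow_mul_real_preimage_openEdges_le` (`InsertionTolerance.lean`).

## References

* G. Grimmett, *The Random-Cluster Model*, Springer 2006: §1.2 (1.2); Thm. (3.1), eqs. (3.3)–(3.4)
  and the finite-energy property (3.4); Thm. (3.21), proof of (3.23) (p. 44). [Grimmett2006]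
-/

noncomputable section

open MeasureTheory Finset
open scoped ENNReal

namespace Summit.CriticalPhenomena.PercolationContinuityZ3.Theorems.FK

open Literature.Probability.Percolation Literature.Probability.LatticeModels

variable {V : Type*} [Fintype V] [DecidableEq V] (G : SimpleGraph V) [DecidableRel G.Adj]

/-! ### One-edge weight inequalities -/

/-- **Opening one edge costs at most the factor `q(1-p)/p` in weight**: for `e ∈ E(G) ∖ ω`,
`ω ⊆ E(G)`, `0 ≤ p ≤ 1`, `q ≥ 1`: `p · w(ω) ≤ q(1-p) · w(ω ∪ {e})` (the cluster count drops by at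
most one). [cite: Grimmett2006, Thm. (3.1) (3.3) and proof of (3.23)] -/
theorem mul_rcWeight_le_insert {p q : ℝ} (hp : p ∈ Set.Icc (0 : ℝ) 1) (hq : 1 ≤ q) (B : Set V)
    {ω : Finset (Sym2 V)} {e : Sym2 V} (he : e ∈ G.edgeFinset) (heω : e ∉ ω) :
    p * rcWeight G p q B ω ≤ q * (1 - p) * rcWeight G p q B (insert e ω) := by
  have hq0 : 0 ≤ q := zero_le_one.trans hq
  have hcard : #(G.edgeFinset \ ω) = #(G.edgeFinset \ insert e ω) + 1 := by
    rw [Finset.sdiff_insert, Finset.card_erase_add_one (Finset.mem_sdiff.2 ⟨he, heω⟩)]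
  have hk : clusterCount (↑ω : BondConfig V) B ≤
      clusterCount (↑(insert e ω) : BondConfig V) B + 1 := by
    rw [Finset.coe_insert]
    exact clusterCount_le_clusterCount_insert_edge_add_one _ e B
  unfold rcWeight
  rw [Finset.card_insert_of_notMem heω, hcard]
  have h1 : q ^ clusterCount (↑ω : BondConfig V) B ≤
      q ^ (clusterCount (↑(insert e ω) : BondConfig V) B + 1) := pow_le_pow_right₀ hq hk
  have hp0 : 0 ≤ p := hp.1
  have hp1 : 0 ≤ 1 - p := sub_nonneg.2 hp.2
  calc p * (p ^ #ω * (1 - p) ^ (#(G.edgeFinset \ insert e ω) + 1) *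
        q ^ clusterCount (↑ω : BondConfig V) B)
      ≤ p * (p ^ #ω * (1 - p) ^ (#(G.edgeFinset \ insert e ω) + 1) *
          q ^ (clusterCount (↑(insert e ω) : BondConfig V) B + 1)) := by
        refine mul_le_mul_of_nonneg_left (mul_le_mul_of_nonneg_left h1 ?_) hp0
        positivity
    _ = q * (1 - p) * (p ^ (#ω + 1) * (1 - p) ^ #(G.edgeFinset \ insert e ω) *
          q ^ clusterCount (↑(insert e ω) : BondConfig V) B) := by ring

/-- **Closing one edge costs at most the factor `p/(1-p)` in weight**: for `e ∈ ω ⊆ E(G)`,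
`0 ≤ p ≤ 1`, `q ≥ 1`: `(1-p) · w(ω) ≤ p · w(ω ∖ {e})` (the cluster count can only go up).
[cite: Grimmett2006, Thm. (3.1) (3.3)] -/
theorem mul_rcWeight_le_erase {p q : ℝ} (hp : p ∈ Set.Icc (0 : ℝ) 1) (hq : 1 ≤ q) (B : Set V)
    {ω : Finset (Sym2 V)} (hω : ω ⊆ G.edgeFinset) {e : Sym2 V} (heω : e ∈ ω) :
    (1 - p) * rcWeight G p q B ω ≤ p * rcWeight G p q B (ω.erase e) := by
  have hq0 : 0 ≤ q := zero_le_one.trans hq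
  have hcardω : #ω = #(ω.erase e) + 1 := (Finset.card_erase_add_one heω).symm
  have hcard : #(G.edgeFinset \ ω.erase e) = #(G.edgeFinset \ ω) + 1 := by
    rw [Finset.sdiff_erase (hω heω), Finset.card_insert_of_notMem]
    exact fun h => (Finset.mem_sdiff.1 h).2 heω
  have hk : clusterCount (↑ω : BondConfig V) B ≤ clusterCount (↑(ω.erase e) : BondConfig V) B :=
    clusterCount_anti (Finset.coe_subset.2 (Finset.erase_subset e ω)) B
  unfold rcWeight
  rw [hcardω, hcard]
  have h1 : q ^ clusterCount (↑ω : BondConfig V) B ≤ q ^ clusterCount (↑(ω.erase e) : BondConfig V) B :=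
    pow_le_pow_right₀ hq hk
  have hp0 : 0 ≤ p := hp.1
  have hp1 : 0 ≤ 1 - p := sub_nonneg.2 hp.2
  calc (1 - p) * (p ^ (#(ω.erase e) + 1) * (1 - p) ^ #(G.edgeFinset \ ω) *
        q ^ clusterCount (↑ω : BondConfig V) B)
      ≤ (1 - p) * (p ^ (#(ω.erase e) + 1) * (1 - p) ^ #(G.edgeFinset \ ω) *
          q ^ clusterCount (↑(ω.erase e) : BondConfig V) B) := by
        refine mul_le_mul_of_nonneg_left (mul_le_mul_of_nonneg_left h1 ?_) hp1
        positivity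
    _ = p * (p ^ #(ω.erase e) * (1 - p) ^ (#(G.edgeFinset \ ω) + 1) *
          q ^ clusterCount (↑(ω.erase e) : BondConfig V) B) := by ring

/-! ### One-edge insertion and deletion tolerance -/

/-- **One-edge insertion tolerance** (Grimmett 2006, (3.4), integrated): for an edge `e` of `G`,
`0 ≤ p ≤ 1`, `q ≥ 1` and every event `A`,
`p · φ{ω | ω ∪ {e} ∈ A} ≤ (p + q(1-p)) · φ(A)`. [cite: Grimmett2006, Thm. (3.1), eq. (3.4)] -/
theorem rcMeasure_real_preimage_insert_le {p q : ℝ} (hp : p ∈ Set.Icc (0 : ℝ) 1) (hq : 1 ≤ q)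
    (B : Set V) {e : Sym2 V} (he : e ∈ G.edgeFinset) (A : Set (BondConfig V)) :
    p * (rcMeasure G p q B).real {ω | insert e ω ∈ A} ≤
      (p + q * (1 - p)) * (rcMeasure G p q B).real A := by
  classical
  have hq0 : 0 < q := one_pos.trans_le hq
  have hZ := rcPartitionFunction_pos G hp hq0 B
  set Z := rcPartitionFunction G p q B with hZdef
  set w : Finset (Sym2 V) → ℝ := fun ω => rcWeight G p q B ω with hw
  -- the target sum restricted to configurations containing `e`
  set a : Finset (Sym2 V) → ℝ := fun η => if (↑η : BondConfig V) ∈ A then w η / Z else 0 with ha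
  have ha0 : ∀ η, 0 ≤ a η := fun η => by
    simp only [ha]
    split_ifs
    · exact div_nonneg (rcWeight_nonneg G hp hq0.le B η) hZ.le
    · exact le_rfl
  rw [rcMeasure_real_apply G hp hq0 B {ω | insert e ω ∈ A}, rcMeasure_real_apply G hp hq0 B A]
  set P := G.edgeFinset.powerset with hP
  set P₁ := P.filter (fun ω => e ∈ ω) with hP₁
  set P₂ := P.filter (fun ω => e ∉ ω) with hP₂
  -- split the left sum by the state of `e`
  have hsplit : ∑ ω ∈ P, (if (↑ω : BondConfig V) ∈ {ω : BondConfig V | insert e ω ∈ A}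
      then w ω / Z else 0) =
      ∑ ω ∈ P₁, a ω + ∑ ω ∈ P₂, (if (↑(insert e ω) : BondConfig V) ∈ A then w ω / Z else 0) := by
    rw [← Finset.sum_filter_add_sum_filter_not P (fun ω => e ∈ ω)]
    congr 1
    · refine Finset.sum_congr rfl fun ω hω => ?_
      have heω : e ∈ ω := (Finset.mem_filter.1 hω).2
      have : insert e (↑ω : BondConfig V) = ↑ω := Set.insert_eq_of_mem (Finset.mem_coe.2 heω)
      simp only [Set.mem_setOf_eq, this, ha]
    · refine Finset.sum_congr rfl fun ω _ => ?_
      simp only [Set.mem_setOf_eq, Finset.coe_insert]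
  -- on `P₂`, compare with the weight of `insert e ω ∈ P₁`
  have hP₂le : p * ∑ ω ∈ P₂, (if (↑(insert e ω) : BondConfig V) ∈ A then w ω / Z else 0) ≤
      q * (1 - p) * ∑ ω ∈ P₂, a (insert e ω) := by
    rw [Finset.mul_sum, Finset.mul_sum]
    refine Finset.sum_le_sum fun ω hω => ?_
    have hωP : ω ⊆ G.edgeFinset := Finset.mem_powerset.1 (Finset.mem_filter.1 hω).1
    have heω : e ∉ ω := (Finset.mem_filter.1 hω).2
    simp only [ha]
    split_ifs with h
    · rw [mul_div_assoc', mul_div_assoc']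
      exact div_le_div_of_nonneg_right (mul_rcWeight_le_insert G hp hq B he heω) hZ.le
    · simp
  -- reindex `P₂ → P₁`, `ω ↦ insert e ω` (injective on `P₂`, lands in `P₁`)
  have hinj : Set.InjOn (fun ω : Finset (Sym2 V) => insert e ω) ↑P₂ := by
    intro ω hω ω' hω' h
    rw [Finset.mem_coe, hP₂, Finset.mem_filter] at hω hω'
    have := congrArg (fun s => Finset.erase s e) h
    simp only [Finset.erase_insert hω.2, Finset.erase_insert hω'.2] at this
    exact this
  have himage : P₂.image (fun ω => insert e ω) ⊆ P₁ := by
    intro η hη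
    obtain ⟨ω, hω, rfl⟩ := Finset.mem_image.1 hη
    rw [hP₂, Finset.mem_filter, Finset.mem_powerset] at hω
    rw [hP₁, Finset.mem_filter, Finset.mem_powerset]
    exact ⟨Finset.insert_subset he hω.1, Finset.mem_insert_self e ω⟩
  have hreindex : ∑ ω ∈ P₂, a (insert e ω) ≤ ∑ η ∈ P₁, a η := by
    rw [← Finset.sum_image hinj]
    exact Finset.sum_le_sum_of_subset_of_nonneg himage fun η _ _ => ha0 η
  have hP₁le : ∑ η ∈ P₁, a η ≤ ∑ η ∈ P, a η :=
    Finset.sum_le_sum_of_subset_of_nonneg (Finset.filter_subset _ P) fun η _ _ => ha0 η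
  rw [hsplit, mul_add]
  have hp0 : 0 ≤ p := hp.1
  have hq1p : 0 ≤ q * (1 - p) := mul_nonneg hq0.le (sub_nonneg.2 hp.2)
  calc p * ∑ ω ∈ P₁, a ω + p * ∑ ω ∈ P₂, (if (↑(insert e ω) : BondConfig V) ∈ A then w ω / Z else 0)
      ≤ p * ∑ η ∈ P₁, a η + q * (1 - p) * ∑ ω ∈ P₂, a (insert e ω) := by
        gcongr
    _ ≤ p * ∑ η ∈ P₁, a η + q * (1 - p) * ∑ η ∈ P₁, a η := by
        gcongr
    _ = (p + q * (1 - p)) * ∑ η ∈ P₁, a η := by ring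
    _ ≤ (p + q * (1 - p)) * ∑ η ∈ P, a η :=
        mul_le_mul_of_nonneg_left hP₁le (add_nonneg hp0 hq1p)

/-- **One-edge deletion tolerance** (Grimmett 2006, (3.4), integrated): for `0 ≤ p ≤ 1`, `q ≥ 1`,
any pair `e` and every event `A`, `(1-p) · φ{ω | ω ∖ {e} ∈ A} ≤ φ(A)`.
[cite: Grimmett2006, Thm. (3.1), eq. (3.4)] -/
theorem rcMeasure_real_preimage_erase_le {p q : ℝ} (hp : p ∈ Set.Icc (0 : ℝ) 1) (hq : 1 ≤ q)
    (B : Set V) (e : Sym2 V) (A : Set (BondConfig V)) :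
    (1 - p) * (rcMeasure G p q B).real {ω | ω \ {e} ∈ A} ≤ (rcMeasure G p q B).real A := by
  classical
  have hq0 : 0 < q := one_pos.trans_le hq
  have hZ := rcPartitionFunction_pos G hp hq0 B
  set Z := rcPartitionFunction G p q B with hZdef
  set w : Finset (Sym2 V) → ℝ := fun ω => rcWeight G p q B ω with hw
  set a : Finset (Sym2 V) → ℝ := fun η => if (↑η : BondConfig V) ∈ A then w η / Z else 0 with ha
  have ha0 : ∀ η, 0 ≤ a η := fun η => by
    simp only [ha]
    split_ifs
    · exact div_nonneg (rcWeight_nonneg G hp hq0.le B η) hZ.le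
    · exact le_rfl
  rw [rcMeasure_real_apply G hp hq0 B {ω | ω \ {e} ∈ A}, rcMeasure_real_apply G hp hq0 B A]
  set P := G.edgeFinset.powerset with hP
  set P₁ := P.filter (fun ω => e ∈ ω) with hP₁
  set P₂ := P.filter (fun ω => e ∉ ω) with hP₂
  have hsplit : ∑ ω ∈ P, (if (↑ω : BondConfig V) ∈ {ω : BondConfig V | ω \ {e} ∈ A}
      then w ω / Z else 0) =
      ∑ ω ∈ P₁, (if (↑(ω.erase e) : BondConfig V) ∈ A then w ω / Z else 0) + ∑ ω ∈ P₂, a ω := by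
    rw [← Finset.sum_filter_add_sum_filter_not P (fun ω => e ∈ ω)]
    congr 1
    · refine Finset.sum_congr rfl fun ω _ => ?_
      simp only [Set.mem_setOf_eq, Finset.coe_erase]
    · refine Finset.sum_congr rfl fun ω hω => ?_
      have heω : e ∉ ω := (Finset.mem_filter.1 hω).2
      have : (↑ω : BondConfig V) \ {e} = ↑ω := by
        rw [sdiff_eq_left, Set.disjoint_singleton_right]
        exact fun h => heω (Finset.mem_coe.1 h)
      simp only [Set.mem_setOf_eq, this, ha]
  have hP₁le : (1 - p) * ∑ ω ∈ P₁, (if (↑(ω.erase e) : BondConfig V) ∈ A then w ω / Z else 0) ≤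
      p * ∑ ω ∈ P₁, a (ω.erase e) := by
    rw [Finset.mul_sum, Finset.mul_sum]
    refine Finset.sum_le_sum fun ω hω => ?_
    have hωP : ω ⊆ G.edgeFinset := Finset.mem_powerset.1 (Finset.mem_filter.1 hω).1
    have heω : e ∈ ω := (Finset.mem_filter.1 hω).2
    simp only [ha]
    split_ifs with h
    · rw [mul_div_assoc', mul_div_assoc']
      exact div_le_div_of_nonneg_right (mul_rcWeight_le_erase G hp hq B hωP heω) hZ.le
    · simp
  have hinj : Set.InjOn (fun ω : Finset (Sym2 V) => ω.erase e) ↑P₁ := by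
    intro ω hω ω' hω' h
    rw [Finset.mem_coe, hP₁, Finset.mem_filter] at hω hω'
    have := congrArg (fun s => insert e s) h
    simp only [Finset.insert_erase hω.2, Finset.insert_erase hω'.2] at this
    exact this
  have himage : P₁.image (fun ω => ω.erase e) ⊆ P₂ := by
    intro η hη
    obtain ⟨ω, hω, rfl⟩ := Finset.mem_image.1 hη
    rw [hP₁, Finset.mem_filter, Finset.mem_powerset] at hω
    rw [hP₂, Finset.mem_filter, Finset.mem_powerset]
    exact ⟨(Finset.erase_subset e ω).trans hω.1, Finset.notMem_erase e ω⟩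
  have hreindex : ∑ ω ∈ P₁, a (ω.erase e) ≤ ∑ η ∈ P₂, a η := by
    rw [← Finset.sum_image hinj]
    exact Finset.sum_le_sum_of_subset_of_nonneg himage fun η _ _ => ha0 η
  have hP₂le : ∑ η ∈ P₂, a η ≤ ∑ η ∈ P, a η :=
    Finset.sum_le_sum_of_subset_of_nonneg (Finset.filter_subset _ P) fun η _ _ => ha0 η
  have hsum0 : 0 ≤ ∑ η ∈ P₂, a η := Finset.sum_nonneg fun η _ => ha0 η
  rw [hsplit, mul_add]
  have hp0 : 0 ≤ p := hp.1
  have hp1 : 0 ≤ 1 - p := sub_nonneg.2 hp.2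
  have hp1' : 1 - p ≤ 1 := sub_le_self 1 hp0
  calc (1 - p) * ∑ ω ∈ P₁, (if (↑(ω.erase e) : BondConfig V) ∈ A then w ω / Z else 0) +
        (1 - p) * ∑ ω ∈ P₂, a ω
      ≤ p * ∑ ω ∈ P₁, a (ω.erase e) + (1 - p) * ∑ ω ∈ P₂, a ω := by
        gcongr
    _ ≤ p * ∑ η ∈ P₂, a η + (1 - p) * ∑ η ∈ P₂, a η := by
        gcongr
    _ = ∑ η ∈ P₂, a η := by ring
    _ ≤ ∑ η ∈ P, a η := hP₂le

/-! ### Insertion and deletion tolerance for finitely many edges -/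

/-- `p + q(1-p) ≥ 1 > 0` for `0 ≤ p ≤ 1`, `q ≥ 1`. [folklore] -/
theorem insertionDenominator_pos {p q : ℝ} (hp : p ∈ Set.Icc (0 : ℝ) 1) (hq : 1 ≤ q) :
    0 < p + q * (1 - p) := by
  nlinarith [hp.1, hp.2, hq]

/-- One-edge insertion tolerance with the constant `π = p/(p + q(1-p))` of Grimmett's (3.4):
`π · φ{ω | ω ∪ {e} ∈ A} ≤ φ(A)`. [cite: Grimmett2006, Thm. (3.1), eq. (3.4)] -/
theorem rcMeasure_div_mul_real_preimage_insert_le {p q : ℝ} (hp : p ∈ Set.Icc (0 : ℝ) 1)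
    (hq : 1 ≤ q) (B : Set V) {e : Sym2 V} (he : e ∈ G.edgeFinset) (A : Set (BondConfig V)) :
    p / (p + q * (1 - p)) * (rcMeasure G p q B).real {ω | insert e ω ∈ A} ≤
      (rcMeasure G p q B).real A := by
  rw [div_mul_eq_mul_div, div_le_iff₀ (insertionDenominator_pos hp hq)]
  have h := rcMeasure_real_preimage_insert_le G hp hq B he A
  linarith

/-- **Insertion tolerance of the finite-volume random-cluster measure** (Grimmett 2006, (3.4)
iterated): for a finite set `F` of edges of `G`, `0 ≤ p ≤ 1`, `q ≥ 1` and every event `A`,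
`(p/(p+q(1-p)))^{|F|} · φ{ω | ω ∪ F ∈ A} ≤ φ(A)`. [cite: Grimmett2006, Thm. (3.1), eq. (3.4)] -/
theorem rcMeasure_pow_mul_real_preimage_openEdges_le {p q : ℝ} (hp : p ∈ Set.Icc (0 : ℝ) 1)
    (hq : 1 ≤ q) (B : Set V) {F : Finset (Sym2 V)} (hF : F ⊆ G.edgeFinset)
    (A : Set (BondConfig V)) :
    (p / (p + q * (1 - p))) ^ #F * (rcMeasure G p q B).real (openEdges (↑F : Set (Sym2 V)) ⁻¹' A) ≤
      (rcMeasure G p q B).real A := by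
  classical
  induction F using Finset.induction_on generalizing A with
  | empty =>
    have : openEdges ((↑(∅ : Finset (Sym2 V))) : Set (Sym2 V)) ⁻¹' A = A := by
      ext ω; simp [openEdges]
    rw [this]
    simp
  | insert e F heF ih =>
    have he : e ∈ G.edgeFinset := hF (Finset.mem_insert_self _ _)
    have hF' : F ⊆ G.edgeFinset := fun x hx => hF (Finset.mem_insert_of_mem hx)
    have hset : openEdges ((↑(insert e F) : Set (Sym2 V))) ⁻¹' A =
        openEdges (↑F : Set (Sym2 V)) ⁻¹' {ω | insert e ω ∈ A} := by
      ext ω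
      simp only [Set.mem_preimage, openEdges, Set.mem_setOf_eq, Finset.coe_insert, Set.union_insert]
    have hc0 : 0 ≤ p / (p + q * (1 - p)) := div_nonneg hp.1 (insertionDenominator_pos hp hq).le
    rw [hset, Finset.card_insert_of_notMem heF, pow_succ]
    calc (p / (p + q * (1 - p))) ^ #F * (p / (p + q * (1 - p))) *
          (rcMeasure G p q B).real (openEdges (↑F : Set (Sym2 V)) ⁻¹' {ω | insert e ω ∈ A})
        = p / (p + q * (1 - p)) * ((p / (p + q * (1 - p))) ^ #F *
          (rcMeasure G p q B).real (openEdges (↑F : Set (Sym2 V)) ⁻¹' {ω | insert e ω ∈ A})) := by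
          ring
      _ ≤ p / (p + q * (1 - p)) * (rcMeasure G p q B).real {ω | insert e ω ∈ A} :=
          mul_le_mul_of_nonneg_left (ih hF' _) hc0
      _ ≤ (rcMeasure G p q B).real A := rcMeasure_div_mul_real_preimage_insert_le G hp hq B he A

/-- **Deletion tolerance of the finite-volume random-cluster measure** (Grimmett 2006, (3.4): the
conditional probability that an edge is closed is at least `1 - p`, iterated): for a finite set `F`
of pairs, `0 ≤ p ≤ 1`, `q ≥ 1` and every event `A`, `(1-p)^{|F|} · φ{ω | ω ∖ F ∈ A} ≤ φ(A)`.
[cite: Grimmett2006, Thm. (3.1), eq. (3.4)] -/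
theorem rcMeasure_pow_mul_real_preimage_sdiff_le {p q : ℝ} (hp : p ∈ Set.Icc (0 : ℝ) 1)
    (hq : 1 ≤ q) (B : Set V) (F : Finset (Sym2 V)) (A : Set (BondConfig V)) :
    (1 - p) ^ #F * (rcMeasure G p q B).real ((fun ω => ω \ (↑F : Set (Sym2 V))) ⁻¹' A) ≤
      (rcMeasure G p q B).real A := by
  classical
  induction F using Finset.induction_on generalizing A with
  | empty =>
    have : (fun ω : BondConfig V => ω \ ((↑(∅ : Finset (Sym2 V))) : Set (Sym2 V))) ⁻¹' A = A := by
      ext ω; simp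
    rw [this]
    simp
  | insert e F heF ih =>
    have hset : (fun ω : BondConfig V => ω \ ((↑(insert e F) : Set (Sym2 V)))) ⁻¹' A =
        (fun ω : BondConfig V => ω \ (↑F : Set (Sym2 V))) ⁻¹' {ω | ω \ {e} ∈ A} := by
      ext ω
      simp only [Set.mem_preimage, Set.mem_setOf_eq, Finset.coe_insert, Set.sdiff_sdiff,
        Set.union_singleton]
    have hc0 : 0 ≤ 1 - p := sub_nonneg.2 hp.2
    rw [hset, Finset.card_insert_of_notMem heF, pow_succ]
    calc (1 - p) ^ #F * (1 - p) *
          (rcMeasure G p q B).real ((fun ω : BondConfig V => ω \ (↑F : Set (Sym2 V))) ⁻¹'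
            {ω | ω \ {e} ∈ A})
        = (1 - p) * ((1 - p) ^ #F *
          (rcMeasure G p q B).real ((fun ω : BondConfig V => ω \ (↑F : Set (Sym2 V))) ⁻¹'
            {ω | ω \ {e} ∈ A})) := by ring
      _ ≤ (1 - p) * (rcMeasure G p q B).real {ω | ω \ {e} ∈ A} :=
          mul_le_mul_of_nonneg_left (ih _) hc0
      _ ≤ (rcMeasure G p q B).real A := rcMeasure_real_preimage_erase_le G hp hq B e A

end Summit.CriticalPhenomena.PercolationContinuityZ3.Theorems.FK

end
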